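import Summits.HodgeConjecture.CorCM.Census.DecicWeil23Multi
import Mathlib.GroupTheory.Perm.Basic
import HarnessLib

/-!
# ANY number of CM fields `K_m ⊇ i_m(k)` of ANY degrees sharing the imaginary quadratic field `k`, ONE type each:
# `E × B_1 × ⋯ × B_r` — the GENERIC finite model of the balanced weights of every product of copies (MULTI-FIELD WEIL, part 1)

COR-CM (cell `pub-hodgecm2`), seat b30 gen 28 (2026-08-23); count-neutral own lane MULTI-FIELD WEIL ENGINE — ONE generic chain in place of
the degree-by-degree chains `Census/SexticOcticWeil*` (`(6,8)`, gen 26), `Census/SexticDecicWeil*` (`(6,10)`), `Census/OcticDecicWeil*`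
(`(8,10)`, gen 27).  Bookkeeping definitions and theorems of a finite model; no named fact, no geometry, no `sorry`, no `decide`.

SETTING (formalised downstream, `CorCM/MultiFieldWeilFrameTransfer`).  `r` CM fields `K_m` (`m < r`) with `[K_m : ℚ] = 2 n_m`, frames
`e_m : Hom(K_m, ℂ) ≃ Fin n_m × Bool` (`(e_m s).2 = [s ∘ i_m = τ]`, `e_m s̄ = ((e_m s).1, ¬(e_m s).2)`), ONE type `Φ_m` per field read at a
POSITION SET `P_m ⊆ Fin n_m`: `s ∈ Φ_m ⟺ (e_m s).2 = [(e_m s).1 ∈ P_m]` (the members over `τ` sit at the positions `P_m`; `k`-signature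
`(|P_m|, n_m − |P_m|)`); `R ⊆ ∏_m Sym(n_m)` the TUPLES of permutations of the conjugate pairs induced by ONE automorphism of `ℂ` fixing `τ`.

MODEL.  `PtG n = Bool ⊕ ((m : Fin r) × (Fin (n m) × Bool))` (`inl b` = the embedding `τ_b` of `k`; `inr ⟨m, (a, b)⟩` = the embedding of
`K_m` of sign `b` in the pair `a`); `phiG P π = {inl true} ⊔ {inr ⟨m, (a, [π m a ∈ P m])⟩} = π⁻¹(types)`; `ModelBalancedG P R v T`: the
equations `2 · #{x ∈ T | v x ∈ phiG P π} = |T|`, `π ∈ R`; `cnt v T y = #{x ∈ T | v x = y}` the fibre counts.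

RESULTS (kernel).  `cjG` (conjugation), membership, `mem_phiG_iff_cjG_not_mem` (each `phiG P π` is a CM type of the model), counting
fibrewise, and **the signed form** `balancedG_iff_signed` of the equation at `π`:
`(N t − N f) + Σ_m Σ_a ± d_m(a) = 0` (`d_m(a) = N⟨m,a,t⟩ − N⟨m,a,f⟩`, sign `+` iff `π m a ∈ P m`).  The DEFECT LAW interface
(`d_m ≡ t_m`, `e = Σ_m c_m t_m`, `c_m = n_m − 2|P_m|`) and its consequences are the sequel `Census/MultiFieldWeilDefect.lean`; the geometric
ENGINE (every configuration obeying the defect law has an algebraic weight line, given only the single-slot Weil parts) is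
`CorCM/MultiFieldWeilEngine.lean`.
[cite: Pohlmann1968, Thm 1] [cite: GaoUllmo2025, Thm 3.1] [cite: MoonenZarhin1995Duke, Thm. 2.4] [cite: Gordon1999HodgeAVSurvey, 5.13 (ii), 9.2.2]

## References
* [Pohlmann1968] H. Pohlmann, Ann. of Math. 88 (1968), Thm 1.  [GaoUllmo2025] Z. Gao, E. Ullmo, J. Inst. Math. Jussieu 25
  (2025), Thm 3.1.  [MoonenZarhin1995Duke] B. Moonen, Yu. Zarhin, Duke Math. J. 77 (1995), Thm. 2.4.  [Gordon1999HodgeAVSurvey]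
  B. B. Gordon, CRM Monogr. 10 (1999), 5.13 (ii), 9.2.2.
-/

namespace Summit.HodgeConjecture.CorCM.Census.MultiFieldWeil

open Finset

/-! ### The model -/

variable {r : ℕ} (n : Fin r → ℕ)

/-- Points: `inl b` = embedding of `k` of sign `b`; `inr ⟨m, (a, b)⟩` = embedding of the `m`-th CM field `K_m` of sign `b` in the conjugate
pair `a < n m`. [cite: GaoUllmo2025, §2.1] -/
abbrev PtG : Type := Bool ⊕ ((m : Fin r) × (Fin (n m) × Bool))

/-- Tuples of permutations of the conjugate pairs, one permutation per field. [folklore] -/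
abbrev PermsG : Type := ∀ m : Fin r, Equiv.Perm (Fin (n m))

variable {n}

/-- Complex conjugation on the model: the sign flips. [folklore] -/
def cjG : PtG n → PtG n
  | Sum.inl b => Sum.inl (!b)
  | Sum.inr ⟨m, (a, b)⟩ => Sum.inr ⟨m, (a, !b)⟩

/-- Unfolding of `cjG`, curve slot. [folklore] -/
theorem cjG_inl (b : Bool) : cjG (n := n) (Sum.inl b) = Sum.inl (!b) := rfl

/-- Unfolding of `cjG`, field slots. [folklore] -/
theorem cjG_inr (m : Fin r) (a : Fin (n m)) (b : Bool) : cjG (Sum.inr ⟨m, (a, b)⟩ : PtG n) = Sum.inr ⟨m, (a, !b)⟩ := rfl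

/-- `cjG` is an involution. [folklore] -/
theorem cjG_cjG (y : PtG n) : cjG (cjG y) = y := by
  rcases y with b | ⟨m, a, b⟩
  · rw [cjG_inl, cjG_inl, Bool.not_not]
  · rw [cjG_inr, cjG_inr, Bool.not_not]

/-- `cjG` has no fixed point. [folklore] -/
theorem cjG_ne (y : PtG n) : cjG y ≠ y := by
  rcases y with b | ⟨m, a, b⟩
  · rw [cjG_inl]; cases b <;> simp
  · rw [cjG_inr]; cases b <;> simp

/-- `cjG` is injective. [folklore] -/
theorem cjG_injective : Function.Injective (cjG (n := n)) := fun y y' h => by rw [← cjG_cjG y, h, cjG_cjG]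

/-- **`π⁻¹(types)` read in the model** (Boolean form): the type of the field `m` is positive exactly at the pairs `(π m)⁻¹ (P m)`, the
curve type is `{τ}`. [cite: GaoUllmo2025, Thm 3.1 (3.2)] -/
def inPhiG (P : ∀ m : Fin r, Finset (Fin (n m))) (π : PermsG n) : PtG n → Bool
  | Sum.inl b => b
  | Sum.inr ⟨m, (a, b)⟩ => b == decide (π m a ∈ P m)

/-- `π⁻¹(types)` as a finset of the model. [cite: GaoUllmo2025, Thm 3.1 (3.2)] -/
def phiG (P : ∀ m : Fin r, Finset (Fin (n m))) (π : PermsG n) : Finset (PtG n) := univ.filter fun y => inPhiG P π y = true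

variable (P : ∀ m : Fin r, Finset (Fin (n m))) (π : PermsG n)

/-- Membership, curve slot. [folklore] -/
theorem inl_mem_phiG (b : Bool) : Sum.inl b ∈ phiG P π ↔ b = true := by
  simp [phiG, inPhiG]

/-- Membership, field slots. [folklore] -/
theorem inr_mem_phiG (m : Fin r) (a : Fin (n m)) (b : Bool) :
    (Sum.inr ⟨m, (a, b)⟩ : PtG n) ∈ phiG P π ↔ b = decide (π m a ∈ P m) := by
  simp only [phiG, inPhiG, Finset.mem_filter, Finset.mem_univ, true_and, beq_iff_eq]

/-- Each `phiG P π` is a CM type of the model: it contains exactly one of `y`, `cjG y`. [folklore] -/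
theorem mem_phiG_iff_cjG_not_mem (y : PtG n) : y ∈ phiG P π ↔ cjG y ∉ phiG P π := by
  rcases y with b | ⟨m, a, b⟩
  · rw [cjG_inl, inl_mem_phiG, inl_mem_phiG]
    cases b <;> simp
  · rw [cjG_inr, inr_mem_phiG, inr_mem_phiG]
    cases b <;> cases decide (π m a ∈ P m) <;> simp

/-! ### Balanced configurations; fibre counts -/

variable {α : Type*}

/-- **Pohlmann's condition for a configuration** of a product of copies of `E, B_1, …, B_r` under a set `R` of realised tuples of
permutations of the conjugate pairs: `2 · #{x ∈ T | v x ∈ π⁻¹(types)} = |T|` for `π ∈ R`. [cite: GaoUllmo2025, Thm 3.1 eq. (3.2)]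
[cite: Pohlmann1968, Thm 1] -/
def ModelBalancedG (R : Finset (PermsG n)) (v : α → PtG n) (T : Finset α) : Prop :=
  ∀ π ∈ R, 2 * (T.filter fun x => v x ∈ phiG P π).card = T.card

/-- **The fibre count** of a configuration over a point of the model: `#{x ∈ T | v x = y}`. [folklore] -/
def cnt (v : α → PtG n) (T : Finset α) (y : PtG n) : ℕ := (T.filter fun x => v x = y).card

variable (R : Finset (PermsG n)) (v : α → PtG n)

/-- Unfolding of `cnt`. [folklore] -/
theorem cnt_eq (T : Finset α) (y : PtG n) : cnt v T y = (T.filter fun x => v x = y).card := rfl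

/-- The empty configuration is balanced. [folklore] -/
theorem modelBalancedG_empty : ModelBalancedG P R v (∅ : Finset α) := fun _ _ => by simp

/-- The empty configuration has no points. [folklore] -/
theorem cnt_empty (y : PtG n) : cnt v (∅ : Finset α) y = 0 := by simp [cnt]

variable {P R v}

/-- **Removing a balanced part keeps the balance.** [folklore] -/
theorem ModelBalancedG.sdiff [DecidableEq α] {T G : Finset α} (hT : ModelBalancedG P R v T) (hG : ModelBalancedG P R v G)
    (hGT : G ⊆ T) : ModelBalancedG P R v (T \ G) := by
  intro π hπ
  have key : ∀ (Q : α → Prop) [DecidablePred Q],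
      ((T \ G).filter Q).card = (T.filter Q).card - (G.filter Q).card := by
    intro Q _
    rw [← Finset.card_sdiff_of_subset (Finset.filter_subset_filter Q hGT)]
    congr 1
    ext x
    simp only [Finset.mem_filter, Finset.mem_sdiff]
    tauto
  have h1 := hT π hπ
  have h2 := hG π hπ
  have h3 := Finset.card_sdiff_of_subset hGT
  have h4 : (G.filter fun x => v x ∈ phiG P π).card ≤ (T.filter fun x => v x ∈ phiG P π).card :=
    Finset.card_le_card (Finset.filter_subset_filter _ hGT)
  rw [key, h3]
  omega

/-- **A disjoint union of balanced configurations is balanced.** [folklore] -/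
theorem ModelBalancedG.union [DecidableEq α] {G S : Finset α} (hG : ModelBalancedG P R v G) (hS : ModelBalancedG P R v S)
    (hGS : Disjoint G S) : ModelBalancedG P R v (G ∪ S) := by
  intro π hπ
  rw [Finset.filter_union, Finset.card_union_of_disjoint (Finset.disjoint_filter_filter hGS),
    Finset.card_union_of_disjoint hGS, mul_add, hG π hπ, hS π hπ]

/-- Fibre counts are monotone. [folklore] -/
theorem cnt_le_cnt_of_subset {G T : Finset α} (hGT : G ⊆ T) (y : PtG n) : cnt v G y ≤ cnt v T y :=
  Finset.card_le_card (Finset.filter_subset_filter _ hGT)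

/-- Fibre counts of a difference. [folklore] -/
theorem cnt_sdiff [DecidableEq α] {G T : Finset α} (hGT : G ⊆ T) (y : PtG n) : cnt v (T \ G) y = cnt v T y - cnt v G y := by
  rw [cnt, cnt, cnt, ← Finset.card_sdiff_of_subset (Finset.filter_subset_filter _ hGT)]
  congr 1
  ext x
  simp only [Finset.mem_filter, Finset.mem_sdiff]
  tauto

/-- Fibre counts of a disjoint union. [folklore] -/
theorem cnt_union [DecidableEq α] {G S : Finset α} (hGS : Disjoint G S) (y : PtG n) : cnt v (G ∪ S) y = cnt v G y + cnt v S y := by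
  rw [cnt, cnt, cnt, Finset.filter_union, Finset.card_union_of_disjoint (Finset.disjoint_filter_filter hGS)]

/-- A point with positive fibre count has a preimage in the configuration. [folklore] -/
theorem exists_mem_of_cnt_pos {T : Finset α} {y : PtG n} (h : 0 < cnt v T y) : ∃ x ∈ T, v x = y := by
  obtain ⟨x, hx⟩ := Finset.card_pos.1 h
  exact ⟨x, (Finset.mem_filter.1 hx).1, (Finset.mem_filter.1 hx).2⟩

/-- A preimage makes the fibre count positive. [folklore] -/
theorem cnt_pos_of_mem {T : Finset α} {x : α} (hx : x ∈ T) : 0 < cnt v T (v x) :=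
  Finset.card_pos.2 ⟨x, Finset.mem_filter.2 ⟨hx, rfl⟩⟩

/-- The fibre count of a singleton. [folklore] -/
theorem cnt_singleton [DecidableEq α] (x : α) (y : PtG n) : cnt v ({x} : Finset α) y = if v x = y then 1 else 0 := by
  rw [cnt, Finset.filter_singleton]
  split_ifs <;> simp

/-! ### Counting fibrewise; the signed form -/

variable (v)

/-- `#{x ∈ T | v x ∈ W} = Σ_{y ∈ W} cnt y`. [folklore] -/
theorem card_filter_mem_eq_sumG (T : Finset α) (W : Finset (PtG n)) :
    (T.filter fun x => v x ∈ W).card = ∑ y ∈ W, cnt v T y := by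
  simp only [cnt]
  rw [Finset.card_eq_sum_card_fiberwise (f := v) (s := T.filter fun x => v x ∈ W) (t := W)
    (fun x hx => (Finset.mem_filter.1 (Finset.mem_coe.1 hx)).2)]
  refine Finset.sum_congr rfl fun y hy => ?_
  congr 1
  ext x
  simp only [Finset.mem_filter]
  constructor
  · rintro ⟨⟨hx, -⟩, hxy⟩; exact ⟨hx, hxy⟩
  · rintro ⟨hx, hxy⟩; exact ⟨⟨hx, hxy ▸ hy⟩, hxy⟩

/-- `|T| = Σ_y cnt y`. [folklore] -/
theorem card_eq_sumG (T : Finset α) : T.card = ∑ y : PtG n, cnt v T y := by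
  rw [← card_filter_mem_eq_sumG v T univ]
  congr 1
  ext x
  simp

/-- A sum over the model, expanded by slots. [folklore] -/
theorem sum_ptG (N : PtG n → ℕ) : ∑ y : PtG n, N y =
    N (Sum.inl true) + N (Sum.inl false) +
      ∑ m : Fin r, ∑ a : Fin (n m), (N (Sum.inr ⟨m, (a, true)⟩) + N (Sum.inr ⟨m, (a, false)⟩)) := by
  rw [Fintype.sum_sum_type, Fintype.sum_bool, Fintype.sum_sigma]
  simp only [Fintype.sum_prod_type, Fintype.sum_bool]

/-- The sum over `phiG P π`, expanded. [folklore] -/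
theorem sum_phiG (N : PtG n → ℕ) :
    ∑ y ∈ phiG P π, N y = N (Sum.inl true) + ∑ m : Fin r, ∑ a : Fin (n m), N (Sum.inr ⟨m, (a, decide (π m a ∈ P m))⟩) := by
  rw [phiG, Finset.sum_filter, Fintype.sum_sum_type, Fintype.sum_bool, Fintype.sum_sigma]
  simp only [inPhiG, Fintype.sum_prod_type, Fintype.sum_bool, beq_iff_eq, if_true, Bool.false_eq_true, if_false, add_zero]
  congr 1
  refine Finset.sum_congr rfl fun m _ => Finset.sum_congr rfl fun a _ => ?_
  cases decide (π m a ∈ P m) <;> simp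

/-- **The signed form of the balance equation at `π`**: `2 Σ_{y ∈ phiG P π} N y = Σ_y N y` iff
`(N t − N f) + Σ_m Σ_a ± d_m(a) = 0`, the sign being `+` iff `π m a ∈ P m`. [cite: GaoUllmo2025, Thm 3.1] -/
theorem balancedG_iff_signed (N : PtG n → ℕ) :
    2 * ∑ y ∈ phiG P π, N y = ∑ y : PtG n, N y ↔
      ((N (Sum.inl true) : ℤ) - N (Sum.inl false)) +
        ∑ m : Fin r, ∑ a : Fin (n m), (if π m a ∈ P m then ((N (Sum.inr ⟨m, (a, true)⟩) : ℤ) - N (Sum.inr ⟨m, (a, false)⟩))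
            else -(((N (Sum.inr ⟨m, (a, true)⟩) : ℤ) - N (Sum.inr ⟨m, (a, false)⟩)))) = 0 := by
  rw [sum_phiG, sum_ptG]
  have key : ∀ (m : Fin r) (a : Fin (n m)), (2 * (N (Sum.inr ⟨m, (a, decide (π m a ∈ P m))⟩)) : ℤ) =
      ((N (Sum.inr ⟨m, (a, true)⟩) : ℤ) + N (Sum.inr ⟨m, (a, false)⟩)) +
        (if π m a ∈ P m then ((N (Sum.inr ⟨m, (a, true)⟩) : ℤ) - N (Sum.inr ⟨m, (a, false)⟩))
          else -(((N (Sum.inr ⟨m, (a, true)⟩) : ℤ) - N (Sum.inr ⟨m, (a, false)⟩)))) := by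
    intro m a
    by_cases h : π m a ∈ P m
    · rw [decide_eq_true h, if_pos h]; ring
    · rw [decide_eq_false h, if_neg h]; ring
  have hsum : (2 * (∑ m : Fin r, ∑ a : Fin (n m), N (Sum.inr ⟨m, (a, decide (π m a ∈ P m))⟩)) : ℤ) =
      (∑ m : Fin r, ∑ a : Fin (n m), (((N (Sum.inr ⟨m, (a, true)⟩)) : ℤ) + N (Sum.inr ⟨m, (a, false)⟩))) +
        ∑ m : Fin r, ∑ a : Fin (n m), (if π m a ∈ P m then ((N (Sum.inr ⟨m, (a, true)⟩) : ℤ) - N (Sum.inr ⟨m, (a, false)⟩))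
          else -(((N (Sum.inr ⟨m, (a, true)⟩) : ℤ) - N (Sum.inr ⟨m, (a, false)⟩)))) := by
    push_cast
    rw [Finset.mul_sum, ← Finset.sum_add_distrib]
    refine Finset.sum_congr rfl fun m _ => ?_
    rw [Finset.mul_sum, ← Finset.sum_add_distrib]
    exact Finset.sum_congr rfl fun a _ => key m a
  constructor
  · intro h
    have hz : (2 : ℤ) * ((N (Sum.inl true) : ℤ) +
        (((∑ m : Fin r, ∑ a : Fin (n m), N (Sum.inr ⟨m, (a, decide (π m a ∈ P m))⟩)) : ℕ) : ℤ)) =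
        (N (Sum.inl true) : ℤ) + N (Sum.inl false) +
          (((∑ m : Fin r, ∑ a : Fin (n m), (N (Sum.inr ⟨m, (a, true)⟩) + N (Sum.inr ⟨m, (a, false)⟩))) : ℕ) : ℤ) := by
      exact_mod_cast h
    push_cast at hz hsum
    linarith
  · intro h
    have hz : (2 : ℤ) * ((N (Sum.inl true) : ℤ) +
        (((∑ m : Fin r, ∑ a : Fin (n m), N (Sum.inr ⟨m, (a, decide (π m a ∈ P m))⟩)) : ℕ) : ℤ)) =
        (N (Sum.inl true) : ℤ) + N (Sum.inl false) +
          (((∑ m : Fin r, ∑ a : Fin (n m), (N (Sum.inr ⟨m, (a, true)⟩) + N (Sum.inr ⟨m, (a, false)⟩))) : ℕ) : ℤ) := by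
      push_cast at hsum ⊢
      linarith
    exact_mod_cast hz

variable {π} (R)

/-- **The defect of a configuration balanced under `R`, at `π ∈ R`** (the signed equation for the fibre counts).
[cite: GaoUllmo2025, Thm 3.1] -/
theorem signed_of_modelBalancedG {T : Finset α} (hT : ModelBalancedG P R v T) {π : PermsG n} (hπ : π ∈ R) :
    (((cnt v T (Sum.inl true)) : ℤ) - cnt v T (Sum.inl false)) +
      ∑ m : Fin r, ∑ a : Fin (n m), (if π m a ∈ P m then ((cnt v T (Sum.inr ⟨m, (a, true)⟩) : ℤ) - cnt v T (Sum.inr ⟨m, (a, false)⟩))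
        else -(((cnt v T (Sum.inr ⟨m, (a, true)⟩)) : ℤ) - cnt v T (Sum.inr ⟨m, (a, false)⟩))) = 0 := by
  rw [← balancedG_iff_signed (P := P) (π := π) (N := cnt v T), ← card_filter_mem_eq_sumG, ← card_eq_sumG v T]
  exact hT π hπ

/-- **Conversely: a configuration whose fibre counts satisfy the signed equation at `π` is balanced at `π`.** [folklore] -/
theorem balancedG_of_signed {T : Finset α} {π : PermsG n}
    (h : (((cnt v T (Sum.inl true)) : ℤ) - cnt v T (Sum.inl false)) +
      ∑ m : Fin r, ∑ a : Fin (n m), (if π m a ∈ P m then ((cnt v T (Sum.inr ⟨m, (a, true)⟩) : ℤ) - cnt v T (Sum.inr ⟨m, (a, false)⟩))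
        else -(((cnt v T (Sum.inr ⟨m, (a, true)⟩)) : ℤ) - cnt v T (Sum.inr ⟨m, (a, false)⟩))) = 0) :
    2 * (T.filter fun x => v x ∈ phiG P π).card = T.card := by
  rw [card_filter_mem_eq_sumG, card_eq_sumG v T, balancedG_iff_signed (P := P) (π := π) (N := cnt v T)]
  exact h

end Summit.HodgeConjecture.CorCM.Census.MultiFieldWeil
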